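import Summits.ResolutionOfSingularities.ResolutionOfSingularities.Theorems.PurelyInseparableDim4PureLeafKGlobalWin
import Summits.ResolutionOfSingularities.ResolutionOfSingularities.Theorems.PurelyInseparableDim4PureLeafFpCorollaries
import HarnessLib
import HarnessLib.Audit.Tags

/-!
# Purely inseparable fourfolds — COROLLARIES of D3d: the degenerate `p`-th-power leaf and the hypothesis-free headlines over EVERY field
# of characteristic `p` (cell res-dim4-pi; companions of `…PureLeafKGlobalWin`)
# [OURS · counted 0 · statements about OUR coordinate-centre frame v4, not about resolution]

Width seat `res-dim4-p-10` (g3).  Over any `[Field K] [CharP K p] [DecidableEq K]`: the leaf `x^a` with EVERY `aᵢ` divisible by `p`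
(a `p`-th power, not a clean state) has every reply cleaning to `0` (`step_F_eq_zero_of_forall_dvd`), so it is an A-win with no real
play and no MODE-1h step leaves it; together with `PureLeafK.stateWins_monomial_charP` / `no_step1h_chain_monomial_charP`:
**`stateWins_monomial_charP_all`**, **`no_step1h_chain_monomial_charP_all`** — EVERY exponent vector, every booking, every field of
characteristic `p`; and the in-scope form `inScopeStateWins_monomial_charP`.

Nothing here proves resolution of singularities in dimension ≥ 4 / characteristic `p`; counted 0; AI work, weaker than expert review.
bears_on: LADDER-RESOLUTION:D157-DOOR2 (res-dim4-pi · D3d corollaries). Supports stmt-ResolutionOfSingularities-16155 (helper).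
-/

set_option linter.dupNamespace false

open MvPolynomial Finset

open scoped BigOperators

noncomputable section

namespace Summit.ResolutionOfSingularities.ResolutionOfSingularities.Theorems.PIDim4

namespace PureLeafK

open Literature.AlgebraicGeometry.Resolution
open Literature.AlgebraicGeometry.Resolution.Hauser2010
open CentreBlowup PthPowerFactor PureLeafNF

variable {K : Type} [Field K] [DecidableEq K] (p : ℕ) [Fact p.Prime] [CharP K p]

omit [Fact p.Prime] [CharP K p] in
/-- A `p`-th-power leaf `x^{a}` (`p ∣ aᵢ` for all `i`) as a `p`-th-power part with root set `{0}`, `μ = 0`, constant `0`. [folklore] -/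
theorem monomial_eq_generalForm_of_forall_dvd (a : Fin 4 → ℕ) (ha : ∀ i, p ∣ a i) :
    (monomial (Finsupp.equivFunOnFinite.symm a) (1 : K)) =
      (∏ i : Fin 4, ∏ c ∈ ({0} : Finset K), (X i + C c) ^ (p * (if c = 0 then a i / p else 0)) : MvPolynomial (Fin 4) K) *
        ((∏ i : Fin 4, ∏ c ∈ ({0} : Finset K), (X i + C c : MvPolynomial (Fin 4) K) ^ (fun (_ : Fin 4) (_ : K) => 0) i c) - C 0) := by
  rw [generalForm_C_zero]
  have h1 : ∀ i : Fin 4, (∏ c ∈ ({0} : Finset K), (X i + C c : MvPolynomial (Fin 4) K) ^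
      (p * (if c = 0 then a i / p else 0) + (fun (_ : Fin 4) (_ : K) => 0) i c)) = X i ^ a i := fun i => by
    rw [Finset.prod_singleton, if_pos rfl, C_0, add_zero]
    show X i ^ (p * (a i / p) + 0) = X i ^ a i
    rw [add_zero, Nat.mul_div_cancel' (ha i)]
  simp_rw [h1]
  rw [monomial_eq, C_1, one_mul, Finsupp.prod_fintype _ _ (fun i => pow_zero _)]
  rfl

/-- **Every reply to a `p`-th-power leaf cleans to `0`** over `K` (singleton centre `{x_j}` with `p ≤ a_j`). [folklore] -/
theorem step_F_eq_zero_of_forall_dvd (s : State K) (a : Fin 4 → ℕ) (ha : ∀ i, p ∣ a i)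
    (hF : s.F = monomial (Finsupp.equivFunOnFinite.symm a) 1) {j : Fin 4} (hj : p ≤ a j) (b : Fin 4 → K) :
    (step p {j} j b s).F = 0 := by
  rw [monomial_eq_generalForm_of_forall_dvd p a ha] at hF
  have hj' : 1 ≤ (fun (i : Fin 4) (c : K) => if c = 0 then a i / p else 0) j 0 := by
    show 1 ≤ (if (0 : K) = 0 then a j / p else 0)
    rw [if_pos rfl]
    exact (Nat.le_div_iff_mul_le (Fact.out : p.Prime).pos).mpr (by rw [one_mul]; exact hj)
  have hSk : ∀ i c, c ∉ ({0} : Finset K) → (fun (i : Fin 4) (c : K) => if c = 0 then a i / p else 0) i c = 0 := fun i c hc => by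
    show (if c = 0 then a i / p else 0) = 0
    rw [if_neg (fun h => hc (by rw [h]; exact Finset.mem_singleton_self 0))]
  rw [step_singleton_generalForm p s {0} _ _ 0 hF hSk (fun _ _ _ => rfl) (fun _ _ => (Fact.out : p.Prime).pos)
    (fun _ _ h => absurd rfl h) hj' b]
  have h1 : (∏ i : Fin 4, ∏ c ∈ Finset.univ.biUnion (fun i => ({0} : Finset K).map (addRightEmbedding (b i))),
      (X i + C c : MvPolynomial (Fin 4) K) ^ (fun (_ : Fin 4) (_ : K) => (0 : ℕ)) i (c - b i)) = 1 :=
    Finset.prod_eq_one fun i _ => Finset.prod_eq_one fun c _ => pow_zero _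
  have h2 : (∏ i : Fin 4, ∏ c ∈ Finset.univ.biUnion (fun i => ({0} : Finset K).map (addRightEmbedding (b i))),
      (c : K) ^ (fun (_ : Fin 4) (_ : K) => (0 : ℕ)) i (c - b i)) = 1 :=
    Finset.prod_eq_one fun i _ => Finset.prod_eq_one fun c _ => pow_zero _
  rw [h1, h2, C_1, sub_self, mul_zero]

omit [DecidableEq K] [Fact p.Prime] [CharP K p] in
/-- Orders of a monomial leaf along coordinate centres, over `K`. [folklore] -/
theorem ordAlong_monomial_leaf (a : Fin 4 → ℕ) (S : Finset (Fin 4)) :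
    ordAlong S (monomial (Finsupp.equivFunOnFinite.symm a) (1 : K)) = ((∑ i ∈ S, a i : ℕ) : ℕ∞) := by
  rw [ordAlong_monomial S _ one_ne_zero]
  rfl

/-- **The degenerate leaf is an A-win over `K`.** [OURS · counted 0] [folklore] -/
theorem stateWins_monomial_charP_of_forall_dvd (a : Fin 4 → ℕ) (ha : ∀ i, p ∣ a i) (r : Fin 4 →₀ ℕ) (exc : Finset (Fin 4)) :
    StateWins p (⟨monomial (Finsupp.equivFunOnFinite.symm a) 1, r, exc⟩ : State K) := by
  unfold StateWins
  by_cases h0 : ∃ j, a j ≠ 0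
  · obtain ⟨j, hj⟩ := h0
    have hpj : p ≤ a j := Nat.le_of_dvd (Nat.pos_of_ne_zero hj) (ha j)
    refine Game.Wins.move (m := ({j} : Finset (Fin 4))) ⟨Finset.singleton_nonempty j, ?_⟩ ?_
    · show (p : ℕ∞) ≤ ordAlong {j} (monomial (Finsupp.equivFunOnFinite.symm a) (1 : K))
      rw [ordAlong_monomial_leaf, Finset.sum_singleton]
      exact_mod_cast hpj
    · rintro s' ⟨j', b, hj', -, -, hne, -⟩
      rw [Finset.mem_singleton] at hj'
      subst hj'
      exact absurd (step_F_eq_zero_of_forall_dvd p _ a ha rfl hpj b) hne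
  · push Not at h0
    refine Game.Wins.terminal fun S hS => ?_
    have h2 := hS.2
    change (p : ℕ∞) ≤ ordAlong S (monomial (Finsupp.equivFunOnFinite.symm a) (1 : K)) at h2
    rw [ordAlong_monomial_leaf, Finset.sum_eq_zero (fun i _ => h0 i)] at h2
    have : p ≤ 0 := by exact_mod_cast h2
    exact absurd (Fact.out : p.Prime).pos (not_lt.mpr this)

/-- **No MODE-1h step leaves the degenerate leaf** over `K`. [OURS · counted 0] [folklore] -/
theorem no_step1h_chain_monomial_charP_of_forall_dvd (a : Fin 4 → ℕ) (ha : ∀ i, p ∣ a i) (r : Fin 4 →₀ ℕ)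
    (exc : Finset (Fin 4)) :
    ¬ ∃ ch : ℕ → State K, ch 0 = (⟨monomial (Finsupp.equivFunOnFinite.symm a) 1, r, exc⟩ : State K) ∧
      ∀ t, Step1h p (ch t) (ch (t + 1)) := by
  rintro ⟨ch, hch0, hch⟩
  obtain ⟨S, ⟨hperm, hmin⟩, j, b, hjS, -, -, hne, -⟩ := hch 0
  rw [hch0] at hperm hmin hne
  have hsum : p ≤ ∑ i ∈ S, a i := by
    have h2 := hperm.2
    change (p : ℕ∞) ≤ ordAlong S (monomial (Finsupp.equivFunOnFinite.symm a) (1 : K)) at h2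
    rw [ordAlong_monomial_leaf] at h2
    exact_mod_cast h2
  obtain ⟨j₀, hj₀S, hj₀⟩ : ∃ j₀ ∈ S, a j₀ ≠ 0 := by
    by_contra hno
    push Not at hno
    rw [Finset.sum_eq_zero hno] at hsum
    exact absurd (Fact.out : p.Prime).pos (not_lt.mpr hsum)
  have hpj₀ : p ≤ a j₀ := Nat.le_of_dvd (Nat.pos_of_ne_zero hj₀) (ha j₀)
  have hperm₀ : IsPermissibleCentre p {j₀} (monomial (Finsupp.equivFunOnFinite.symm a) (1 : K)) := by
    refine ⟨Finset.singleton_nonempty j₀, ?_⟩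
    rw [ordAlong_monomial_leaf, Finset.sum_singleton]
    exact_mod_cast hpj₀
  have hcard := hmin {j₀} hperm₀
  rw [Finset.card_singleton] at hcard
  obtain ⟨j', hj'⟩ := Finset.card_eq_one.mp (le_antisymm hcard (Finset.card_pos.mpr hperm.1))
  rw [hj', Finset.mem_singleton] at hjS
  subst hjS
  rw [hj'] at hsum hne
  rw [Finset.sum_singleton] at hsum
  exact hne (step_F_eq_zero_of_forall_dvd p _ a ha rfl hsum b)

/-- **EVERY PURE MONOMIAL `x^a`, EVERY BOOKING, EVERY FIELD OF CHARACTERISTIC `p`: an A-win of the plain global game.**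
[OURS · counted 0] [folklore] -/
theorem stateWins_monomial_charP_all (a : Fin 4 → ℕ) (r : Fin 4 →₀ ℕ) (exc : Finset (Fin 4)) :
    StateWins p (⟨monomial (Finsupp.equivFunOnFinite.symm a) 1, r, exc⟩ : State K) := by
  by_cases ha : ∃ i, ¬ p ∣ a i
  · exact stateWins_monomial_charP p a ha r exc
  · push Not at ha
    exact stateWins_monomial_charP_of_forall_dvd p a ha r exc

/-- **… and MODE 1h terminates from it.** [OURS · counted 0] [folklore] -/
theorem no_step1h_chain_monomial_charP_all (a : Fin 4 → ℕ) (r : Fin 4 →₀ ℕ) (exc : Finset (Fin 4)) :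
    ¬ ∃ ch : ℕ → State K, ch 0 = (⟨monomial (Finsupp.equivFunOnFinite.symm a) 1, r, exc⟩ : State K) ∧
      ∀ t, Step1h p (ch t) (ch (t + 1)) := by
  by_cases ha : ∃ i, ¬ p ∣ a i
  · exact no_step1h_chain_monomial_charP p a ha r exc
  · push Not at ha
    exact no_step1h_chain_monomial_charP_of_forall_dvd p a ha r exc

/-- The in-scope form over `K`. [OURS · counted 0] [folklore] -/
theorem inScopeStateWins_monomial_charP (a : Fin 4 → ℕ) (r : Fin 4 →₀ ℕ) (exc : Finset (Fin 4)) :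
    InScopeWinCert.InScopeStateWins p (⟨monomial (Finsupp.equivFunOnFinite.symm a) 1, r, exc⟩ : State K) :=
  InScopeWinCert.inScopeStateWins_of_stateWins (stateWins_monomial_charP_all p a r exc)

end PureLeafK

end Summit.ResolutionOfSingularities.ResolutionOfSingularities.Theorems.PIDim4

end
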